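import Summits.AtomisticToContinuum.Crystallization.Theorems.PalmUnimodularRigidityMinimiserShellsOfSepPeriodicShellGap
import Summits.AtomisticToContinuum.Crystallization.Theorems.PalmUnimodularRigidityMinimiserShellsNecessitySandwich

/-!
# Crux `MinimiserShells` (stmt-AtomisticToContinuum-9225) SANDWICHED by the hard-core periodic shell gap

Line `equilibrium-in-law-surgery`, reshape r6 (lead `…-c3-0`).  Crux decl
`Summit.AtomisticToContinuum.Crystallization.Theses.PalmUnimodularRigidity.MinimiserShells`.

The line's residual stub S7⁗ (`stub_sepPeriodicShellGap`: for every `t > 0` some `κ > 0` separates from `e*` the energy per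
particle of every `1/3`-hard-core periodic configuration with at least `t·#motif` badly-shelled motif sites) implies the crux
(`OfSepPeriodicShellGap.minimiserShells_of_sepPeriodicShellGap`, all transfers landed), and the crux implies S7⁗ with the
bad-shell predicate LOOSENED by any `θ ∈ (0, 1/10]` — tolerance `a/100 + θ`, radius `(5/4 − θ)·a` —
(`NecessitySandwich.stub_necessity_sandwich`: blocks of a failing sequence, their Benjamini–Schramm limit, robustness of good
shells under local matching).  `minimiserShells_sandwich` records both directions as one theorem: the crux IS bulk energetic
crystallization of three-dimensional Lennard-Jones in periodic shell form on the uniformly discrete class, up to the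
closed-tolerance boundary of the shell predicate (exact necessity at `θ = 0` fails only there: the bad-shell event is not closed in
the local topology at a matching error of exactly `a/100` with an atom at exactly `5a/4`).
-/

noncomputable section

open MeasureTheory
open scoped ENNReal BigOperators Classical

namespace Summit.AtomisticToContinuum.Crystallization.Theorems.PalmUnimodularRigidityMinimiserShells.Sandwich

open Literature.MathematicalPhysics.StatisticalMechanics (lennardJones interactionEnergy PeriodicConfiguration)
open Summit.AtomisticToContinuum.Crystallization.Theses.PalmUnimodularRigidity (MinimiserShells)
open Summit.AtomisticToContinuum.Crystallization.Theorems.MinimiserShells.Negative.LoadBearing (eStar GoodShell)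

/-- **The sandwich** (registered marker `minimiserShells_sandwich`): (i) the `1/3`-hard-core periodic shell gap implies
`MinimiserShells`; (ii) `MinimiserShells` implies the `1/3`-hard-core periodic shell gap for the `θ`-loosened bad-shell predicate,
every `θ ∈ (0, 1/10]`. -/
theorem minimiserShells_sandwich :
    ((∀ t : ℝ, 0 < t → ∃ κ : ℝ, 0 < κ ∧ ∀ Q : PeriodicConfiguration 3,
      (∀ p ∈ Q.points, ∀ q ∈ Q.points, p ≠ q → (1 : ℝ) / 3 ≤ dist p q) →
      t * (Q.motif.card : ℝ) ≤ (Nat.card {x : Q.motif // ¬ GoodShell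
          ((Measure.count : Measure (EuclideanSpace ℝ (Fin 3))).restrict
            ((fun z => z - (x : EuclideanSpace ℝ (Fin 3))) '' Q.points))} : ℝ) →
      eStar + κ ≤ Q.energyPerParticle lennardJones) → MinimiserShells) ∧
    (MinimiserShells →
     (∀ θ : ℝ, 0 < θ → θ ≤ 1 / 10 → ∀ t : ℝ, 0 < t → ∃ κ : ℝ, 0 < κ ∧
      ∀ Q : PeriodicConfiguration 3,
        (∀ p ∈ Q.points, ∀ q ∈ Q.points, p ≠ q → (1 : ℝ) / 3 ≤ dist p q) →
        t * (Q.motif.card : ℝ) ≤ (Nat.card {x : Q.motif // ¬ (∃ a : ℝ, 9 / 10 ≤ a ∧ a ≤ 1 ∧ ∃ T : Finset (EuclideanSpace ℝ (Fin 3)),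
            (↑T : Set (EuclideanSpace ℝ (Fin 3))) = {w : EuclideanSpace ℝ (Fin 3) | ((Measure.count : Measure (EuclideanSpace ℝ (Fin 3))).restrict ((fun z => z - (x : EuclideanSpace ℝ (Fin 3))) '' Q.points)) {w} ≠ 0 ∧ w ≠ 0 ∧ ‖w‖ ≤ (5 / 4 - θ) * a} ∧
            (Literature.Geometry.DiscreteGeometry.ShellCloseTo (a / 100 + θ) T
              (Finset.image (fun v : EuclideanSpace ℝ (Fin 3) => a • v) Literature.Geometry.DiscreteGeometry.fccKissingPattern) ∨
             Literature.Geometry.DiscreteGeometry.ShellCloseTo (a / 100 + θ) T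
              (Finset.image (fun v : EuclideanSpace ℝ (Fin 3) => a • v) Literature.Geometry.DiscreteGeometry.hcpKissingPattern)))} : ℝ) →
        eStar + κ ≤ Q.energyPerParticle lennardJones)) :=
  ⟨OfSepPeriodicShellGap.minimiserShells_of_sepPeriodicShellGap, NecessitySandwich.stub_necessity_sandwich⟩

end Summit.AtomisticToContinuum.Crystallization.Theorems.PalmUnimodularRigidityMinimiserShells.Sandwich

end
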